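import Mathlib
import HarnessLib
import Summits.SmoothPoincare4.SmoothPoincare4.Theses.IsotropicCorkBracketing

/-!
# Route IsotropicCorkBracketing — item `CorkReduction` (stmt-SmoothPoincare4-9832)

LAYER-2 GLUE of route IsotropicCorkBracketing: the pure-logic composition

  `CorkPresentation → SeamNull → NeumannBracketing → CorkIsotropicBracketing → IsotropicFormPositive`.

Given a closed smooth `M ≃ₕ S⁴`, `CorkPresentation` presents `M` as a twisted boundary gluing
`C ∪_(φ∘τ) W` of the two pieces of a splitting `S⁴ = C ∪_φ W` (explicit piece embeddings
`jC`, `jW`); `CorkIsotropicBracketing` supplies a Riemannian metric `G` on `M` whose isotropic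
Yamabe form is Neumann-positive on each of the closed pieces `range jC`, `range jW`;
`SeamNull` says the seam `range jC ∩ range jW` is `dV_G`-null; `NeumannBracketing` adds the two
piece inequalities up to positivity on all of `M`.  The only non-logical ingredient is that the
ranges of the compact pieces under the (continuous) smooth embeddings are closed in the
Hausdorff `M`.

Sources: Bröcker–Jänich 1982 (gluing of manifolds with boundary), Hirsch 1976; the analytic
content lives in the four hypotheses.
-/

-- the prescribed namespace `Summit.<P>.<Sub>.…` duplicates `SmoothPoincare4` (P = Sub)
set_option linter.dupNamespace false

namespace Summit.SmoothPoincare4.SmoothPoincare4.Theorems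

open Summit.SmoothPoincare4.SmoothPoincare4.Theses.IsotropicCorkBracketing

/-- **Item `CorkReduction` (stmt-SmoothPoincare4-9832) of route IsotropicCorkBracketing.**
The layer-2 glue `CorkPresentation → SeamNull → NeumannBracketing → CorkIsotropicBracketing →
IsotropicFormPositive`: present the homotopy 4-sphere `M` as a cork twist (CorkPresentation),
take the piecewise Neumann-positive metric (CorkIsotropicBracketing), note the seam is null
(SeamNull) and the piece ranges are closed (compact pieces, continuous embeddings, `M`
Hausdorff), and bracket (NeumannBracketing). -/
theorem corkReduction_proof :
    Summit.SmoothPoincare4.SmoothPoincare4.Theses.IsotropicCorkBracketing.CorkReduction := by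
  unfold CorkReduction
  intro hP hN hB hK M _ _ _ _ _ _ _ _ e
  obtain ⟨C, _, _, _, _, _, _, _, ZC, _, _, _, ιC, hιC, hιC', W, _, _, _, _, _, _, ZW, _, _, _,
    ιW, hιW, hιW', φ, τ, hS4, jC, jW, hjC, hjW, hcov, hseam⟩ := hP M e
  obtain ⟨G, hG, hLC, hposC, hposW⟩ :=
    hK C ZC ιC hιC hιC' W ZW ιW hιW hιW' φ τ hS4 M jC jW hjC hjW hcov hseam
  haveI := hLC
  have hnull := hN C ZC ιC hιC hιC' W ZW ιW hιW hιW' (τ.trans φ) M jC jW hjC hjW hcov hseam G hG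
  have hC_closed : IsClosed (Set.range jC) :=
    (isCompact_range hjC.isEmbedding.continuous).isClosed
  have hW_closed : IsClosed (Set.range jW) :=
    (isCompact_range hjW.isEmbedding.continuous).isClosed
  exact ⟨G, hG, hLC, hB M G hG (Set.range jC) (Set.range jW) hC_closed hW_closed hcov hnull
    hposC hposW⟩

end Summit.SmoothPoincare4.SmoothPoincare4.Theorems
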